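import Mathlib
import HarnessLib
import Summits.HubbardSuperconductivity.HubbardSuperconductivity.Theorems.KLProgrammeKLRegimeTwoVolumeSrcSectorScaleSuccBundledP
import Summits.HubbardSuperconductivity.HubbardSuperconductivity.Theorems.KLProgrammeKLRegimeTwoVolumeFrameComposite
import Summits.HubbardSuperconductivity.HubbardSuperconductivity.Theorems.KLProgrammeKLRegimeTwoVolumeStepProfileKit
import Summits.HubbardSuperconductivity.HubbardSuperconductivity.Theorems.KLProgrammeKLRegimeTwoVolumeGluedTruncation

/-!
# Route `KLProgramme` — crux K3, VL child `KLRegimeVolumeLimitV17F2` (stmt-HubbardSuperconductivity-20440), blueprint v5 M5: ONE SCALE OF THE NESTED TWO-VOLUME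
# INDUCTION, COMPOSITE FORM — own-frame fine step = frame composite (M3f) + two-volume step (MinS) + splice (seat hubbard-kl-k3c4-p1 g12; `--supports` 20440)

The induction state at a scale is the keyed deep defect between the fine volume's OWN-FRAME action `𝒲′` (frame `K″ = K_{L″}`) and the coarse volume's action
`𝒲` (frame `K = K_L`).  One scale later the fine object is `effAction C⁺[K″] (map T⁺[K″] 𝒲′)` and the coarse one `effAction C⁺[K] (map T⁺[K] 𝒲)`; the
two-volume step `…SrcSectorScaleSuccBundledP` compares the frame-`K` TWIN `effAction C⁺[K]_{L″} (map T⁺[K]_{L″} 𝒲′)` (same sampled symbols on both lattices) with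
the glued coarse object, the frame composite `…TwoVolumeFrameComposite` compares the own-frame fine object with that twin, and k3c5-p3's splice
`…GluedTruncation.sum_norm_keyedGlued_le_of_fine_response` adds the two.  The twin's one-volume profile (MinS's `hNW′`, M3f's `hNW`) is DERIVED from the raw
weighted profile of `𝒲′` by `…StepProfileKit.wtProfileEven_map_of_wtProfileRaw`; the plain profiles M3f wants are the weighted ones.

* **`srcSector_sum_norm_kernel_twoVolume_scaleSucc_composite_le`** — the displayed bound `≤ M3f-RHS + MinS-RHS` at every deep pin, every degree.

Generic in the lattice sizes and sector counts (the model instantiation is a separate file); proofs only; no definition.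
-/

noncomputable section

namespace Summit.HubbardSuperconductivity.HubbardSuperconductivity.Theorems.TwoVolumeDefect

set_option linter.dupNamespace false -- summit = problem name (single-conjunct summit), D-0017

open Finset Literature.MathematicalPhysics.QuantumLattice GrassmannAlgebra Literature.Probability.LatticeModels
  Literature.Probability.LatticeModels.BattleFederbush
open Summit.HubbardSuperconductivity.HubbardSuperconductivity.Theorems.TwoPointAssembly

set_option maxHeartbeats 400000 in -- two ~120-binder instantiations
/-- **ONE SCALE OF THE NESTED TWO-VOLUME INDUCTION, COMPOSITE FORM** (see the module docstring): at an `(R+R′)`-deep pin, in every degree, the keyed defect between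
the fine volume's own-frame next action and the glued coarse next action is at most the frame composite's bound plus the two-volume step's bound.
[folklore: composition; cite: BenfattoGiulianiMastropietro2006, §2.7-§2.9 and §3] -/
theorem srcSector_sum_norm_kernel_twoVolume_scaleSucc_composite_le {b L Lf M N N₁ : ℕ} [NeZero Lf] [NeZero L] [NeZero M]
    [LinearOrder ((SpaceTimeIdx Lf M × SectorLeg N) × Fin 2)]
    (hLf : Lf = b * L) {β : ℝ} (hβ : β ≠ 0) {Λ : ℝ} (hΛ : 0 < Λ)
    -- the block structures of the scale-`j+1` and scale-`j` legs and their doublings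
    (e : (SpaceTimeIdx Lf M × SectorLeg N) ≃ (Fin 2 → Fin b) × (SpaceTimeIdx L M × SectorLeg N))
    (he1 : ∀ X' i, ((e X').1 i : ℕ) = (X'.1.2 i).val / L) (he2 : ∀ X', (e X').2 = ((X'.1.1, fun i => (((X'.1.2 i).val : ℕ) : ZMod L)), X'.2))
    (ed : ((SpaceTimeIdx Lf M × SectorLeg N) × Fin 2) ≃ (Fin 2 → Fin b) × ((SpaceTimeIdx L M × SectorLeg N) × Fin 2)) (hed : ∀ x s, ed (x, s) = ((e x).1, ((e x).2, s)))
    (e₁ : (SpaceTimeIdx Lf M × SectorLeg N₁) ≃ (Fin 2 → Fin b) × (SpaceTimeIdx L M × SectorLeg N₁))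
    (he₁1 : ∀ X' i, ((e₁ X').1 i : ℕ) = (X'.1.2 i).val / L) (he₁2 : ∀ X', (e₁ X').2 = ((X'.1.1, fun i => (((X'.1.2 i).val : ℕ) : ZMod L)), X'.2))
    (ed₁ : ((SpaceTimeIdx Lf M × SectorLeg N₁) × Fin 2) ≃ (Fin 2 → Fin b) × ((SpaceTimeIdx L M × SectorLeg N₁) × Fin 2)) (hed₁ : ∀ x s, ed₁ (x, s) = ((e₁ x).1, ((e₁ x).2, s)))
    -- the sampled fat family and symbol of the STEP covariances, the spectator lifts
    (𝔣t : Fin N → MatsubaraIdx M → (Fin 2 → ℝ) → ℂ) (Φ : MatsubaraIdx M → Fin 2 → (Fin 2 → ℝ) → ℂ)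
    (FtL : Fin N → FreqMomentum L M → ℂ) (FtLf : Fin N → FreqMomentum Lf M → ℂ)
    (hFtL : ∀ ω i q, FtL ω (i, q) = 𝔣t ω i (latticeMomentum L q)) (hFtLf : ∀ ω i q, FtLf ω (i, q) = 𝔣t ω i (latticeMomentum Lf q))
    (pL : FreqMomentum L M × Fin 2 → ℂ) (pLf : FreqMomentum Lf M × Fin 2 → ℂ)
    (hpL : ∀ i q σ, pL ((i, q), σ) = ((β * (L : ℝ) ^ 2 : ℝ) : ℂ) * Φ i σ (latticeMomentum L q))
    (hpLf : ∀ i q σ, pLf ((i, q), σ) = ((β * (Lf : ℝ) ^ 2 : ℝ) : ℂ) * Φ i σ (latticeMomentum Lf q))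
    (CL : Matrix (SpaceTimeIdx L M × SectorLeg N) (SpaceTimeIdx L M × SectorLeg N) ℂ)
    (hCL : CL = (sectorSubMatrix L M β FtL).transpose * normalCovariance L M pL * sectorSubMatrix L M β FtL)
    (CLf : Matrix (SpaceTimeIdx Lf M × SectorLeg N) (SpaceTimeIdx Lf M × SectorLeg N) ℂ)
    (hCLf : CLf = (sectorSubMatrix Lf M β FtLf).transpose * normalCovariance Lf M pLf * sectorSubMatrix Lf M β FtLf)
    (Cd : Matrix ((SpaceTimeIdx L M × SectorLeg N) × Fin 2) ((SpaceTimeIdx L M × SectorLeg N) × Fin 2) ℂ) (hCd : ∀ p q, Cd p q = if p.2 = 0 ∧ q.2 = 0 then CL p.1 q.1 else 0)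
    (Cd' : Matrix ((SpaceTimeIdx Lf M × SectorLeg N) × Fin 2) ((SpaceTimeIdx Lf M × SectorLeg N) × Fin 2) ℂ) (hCd' : ∀ p q, Cd' p q = if p.2 = 0 ∧ q.2 = 0 then CLf p.1 q.1 else 0)
    -- the re-analysis blocks `T_V` related by periodisation, the source relabellings `J_V`, the block substitutions `T⁺_V`
    (Tc : Matrix (SpaceTimeIdx L M × SectorLeg N) (SpaceTimeIdx L M × SectorLeg N₁) ℂ)
    (Tf : Matrix (SpaceTimeIdx Lf M × SectorLeg N) (SpaceTimeIdx Lf M × SectorLeg N₁) ℂ)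
    (hPT₀ : ∀ (X' : (SpaceTimeIdx Lf M × SectorLeg N)) (Y : (SpaceTimeIdx L M × SectorLeg N₁)),
      ∑ Y'' ∈ univ.filter (fun Y'' : (SpaceTimeIdx Lf M × SectorLeg N₁) => (e₁ Y'').2 = Y), Tf X' Y'' = Tc (e X').2 Y)
    (Jc : Matrix (SpaceTimeIdx L M × SectorLeg N) (SpaceTimeIdx L M × SectorLeg N₁) ℂ) (Jf : Matrix (SpaceTimeIdx Lf M × SectorLeg N) (SpaceTimeIdx Lf M × SectorLeg N₁) ℂ)
    (hPJ : ∀ (X' : (SpaceTimeIdx Lf M × SectorLeg N)) (Y : (SpaceTimeIdx L M × SectorLeg N₁)),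
      ∑ Y'' ∈ univ.filter (fun Y'' : (SpaceTimeIdx Lf M × SectorLeg N₁) => (e₁ Y'').2 = Y), Jf X' Y'' = Jc (e X').2 Y)
    (Tpc : Matrix ((SpaceTimeIdx L M × SectorLeg N) × Fin 2) ((SpaceTimeIdx L M × SectorLeg N₁) × Fin 2) ℂ)
    (hTpc : ∀ p' p, Tpc p' p = if p'.2 = 0 ∧ p.2 = 0 then Tc p'.1 p.1 else if p'.2 = 1 ∧ p.2 = 1 then Jc p'.1 p.1 else 0)
    (Tpf : Matrix ((SpaceTimeIdx Lf M × SectorLeg N) × Fin 2) ((SpaceTimeIdx Lf M × SectorLeg N₁) × Fin 2) ℂ)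
    (hTpf : ∀ p' p, Tpf p' p = if p'.2 = 0 ∧ p.2 = 0 then Tf p'.1 p.1 else if p'.2 = 1 ∧ p.2 = 1 then Jf p'.1 p.1 else 0)
    -- the region schedule: zone depth `R`, extra pin depth `R′`, transfer radii `RN ≤ RZ`, `RF`, tail radius `r` (`r ≤ RN`, `r ≤ RF`, `r + RZ ≤ R`); the pin
    (R R' RN RZ RF r : ℕ) (hNZ : RN ≤ RZ) (hrN : r ≤ RN) (hrF : r ≤ RF) (hrZR : r + RZ ≤ R)
    (w : ((SpaceTimeIdx Lf M × SectorLeg N) × Fin 2)) (hw : ∀ j, R + R' ≤ (w.1.1.2 j).val % L ∧ (w.1.1.2 j).val % L + (R + R') < L)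
    -- ONE-VOLUME COVARIANCE DATA (bundled), both volumes; the fine sectional row
    {κ κ' αW αW' sW sW' eW' : ℝ} (hC : ScaleCovData CL Λ κ αW sW) (hC' : ScaleCovData CLf Λ κ' αW' sW') (hCsec : ScaleCovSecData CLf Λ eW')
    -- ONE-VOLUME TRANSFER DATA of `T⁺_{L″}` (bundled)
    {ΛT cW : ℝ} (hTr : TransferWtData Tpf ed ed₁ ΛT cW)
    -- the two DOUBLED scale-`j` actions (parity, no constant part) and their ONE-VOLUME profiles: the coarse previous action at its own rate `Λ₁` (raw degree),
    -- the two re-analysed inputs at rate `Λ` (the engine's sub-diagonal read-outs), the coarse step's field radius `ρ₀` and its smallness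
    (𝒲 : GrassmannAlgebra ℂ ((SpaceTimeIdx L M × SectorLeg N₁) × Fin 2)) (h𝒲e : 𝒲 ∈ evenOdd ℂ 0) (h𝒲0 : constPart ℂ 𝒲 = 0)
    (𝒲' : GrassmannAlgebra ℂ ((SpaceTimeIdx Lf M × SectorLeg N₁) × Fin 2)) (h𝒲'e : 𝒲' ∈ evenOdd ℂ 0) (h𝒲'0 : constPart ℂ 𝒲' = 0)
    {Λ₁ : ℝ} (hΛ₁ : 0 ≤ Λ₁) (N𝒲 NV NW' : ℕ → ℝ) (hN𝒲 : WtProfileRaw 𝒲 Λ₁ N𝒲)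
    (hNV : WtProfileEven (ExteriorAlgebra.map (Matrix.toLin' Tpc) 𝒲) Λ NV)
    -- the fine previous own-frame action's raw weighted profile; the HYBRID re-analysis profile is derived (`…StepProfileKit`)
    (N𝒲' : ℕ → ℝ) (hN𝒲' : WtProfileRaw 𝒲' Λ₁ N𝒲') (hΛT : Λ ≤ ΛT) (hΛΛ₁ : Λ ≤ Λ₁)
    (hNW'def : ∀ m', NW' m' = cW ^ (2 * m' - 1) * (cW * N𝒲' (2 * m')))
    {ρ₀ : ℝ} (hρ₀ : 0 < ρ₀) (hθ₀ : Real.exp 1 * αW * normV ((SpaceTimeIdx L M × SectorLeg N) × Fin 2) κ ρ₀ NV / κ ^ 2 < 1)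
    (Nw : ℕ → ℝ) (hNwdef : ∀ m', Nw m' = ρ₀⁻¹ ^ (2 * m') * (Real.exp 1 * normV ((SpaceTimeIdx L M × SectorLeg N) × Fin 2) κ ρ₀ NV) / (1 - Real.exp 1 * αW * normV ((SpaceTimeIdx L M × SectorLeg N) × Fin 2) κ ρ₀ NV / κ ^ 2))
    -- the other field radii and the smallness conditions of the two-volume step (α = m₁ = s := αW, primed := αW′)
    {ρf : ℝ} (hρf : 0 < ρf)
    (hθw : Real.exp 1 * (αW' + αW + (αW' + αW)) * normV ((SpaceTimeIdx Lf M × SectorLeg N) × Fin 2) (κ' + κ) ρf Nw / (κ' + κ) ^ 2 < 1)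
    {ρ₂ : ℝ} (hρ₂ : 0 < ρ₂)
    (hθ₂ : Real.exp 1 * (αW' + αW + (αW' + αW)) * normV ((SpaceTimeIdx Lf M × SectorLeg N) × Fin 2) (κ' + κ + (κ' + κ + (κ' + κ))) ρ₂ Nw /
      (κ' + κ + (κ' + κ + (κ' + κ))) ^ 2 < 1)
    -- the scale-`j` TWO-VOLUME data (induction hypothesis) in block-reduced form, the transfer majorant `Ein` with `aT := cW`, `τT := cW/(1+Λ_T(r+1))`,
    -- `Nj := N𝒲`, `Nfarj := N𝒲/(1+Λ₁(RZ−RN+1))`, its cap, and the two smallness conditions of the interaction bracket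
    (Ej NDj : ℕ → ℝ) (hD : KeyedDefectData (N := N) ed₁ 𝒲' 𝒲 R RF Ej NDj)
    (Ein : ℕ → ℝ) (hEin0 : ∀ m', 0 ≤ Ein m')
    (hEin : ∀ m', 1 ≤ m' → ∀ n : ℕ, 2 * m' = n + 1 →
      cW ^ n * (cW * Ej (n + 1) + cW / (1 + ΛT * ((r : ℝ) + 1)) * NDj (n + 1)) +
        (2 * cW ^ n * (cW / (1 + ΛT * ((r : ℝ) + 1))) * N𝒲 (n + 1) +
          n * cW ^ n * (5 * (cW / (1 + ΛT * ((r : ℝ) + 1))) * N𝒲 (n + 1) + 2 * cW * ((1 + Λ₁ * (((RZ - RN : ℕ) : ℝ) + 1))⁻¹ * N𝒲 (n + 1)))) ≤ Ein m')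
    {ρ' : ℝ} (hρ' : 0 < ρ') {νEbar : ℝ} (hνE : normV ((SpaceTimeIdx Lf M × SectorLeg N) × Fin 2) κ' ρ' Ein ≤ νEbar)
    (hbar : Real.exp 1 * αW' * (normV ((SpaceTimeIdx Lf M × SectorLeg N) × Fin 2) κ' ρ' (fun m' => NV m' + (NW' m' + NV m')) + νEbar) / κ' ^ 2 < 1)
    (hθ₂' : Real.exp 1 * αW' * (normV ((SpaceTimeIdx Lf M × SectorLeg N) × Fin 2) κ' ρ' NV + normV ((SpaceTimeIdx Lf M × SectorLeg N) × Fin 2) κ' ρ' (fun m' => NW' m' + NV m')) / κ' ^ 2 < 1)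
    -- THE FINE VOLUME'S OWN-FRAME STEP (blueprint M3f): covariance `C⁺[K″]` (spectator lift of `CLf″`) and transfer `T⁺[K″]` on `L″`, the Gram constant of the
    -- frame path, the entry sup / rows / columns of the covariance defect `CLf″ − CLf`, the rows / columns of the transfer defect, one field radius, two smallness lines
    (CLf'' : Matrix (SpaceTimeIdx Lf M × SectorLeg N) (SpaceTimeIdx Lf M × SectorLeg N) ℂ)
    (Cd'' : Matrix ((SpaceTimeIdx Lf M × SectorLeg N) × Fin 2) ((SpaceTimeIdx Lf M × SectorLeg N) × Fin 2) ℂ)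
    (hCd'' : ∀ p q, Cd'' p q = if p.2 = 0 ∧ q.2 = 0 then CLf'' p.1 q.1 else 0)
    (Tpf'' : Matrix ((SpaceTimeIdx Lf M × SectorLeg N) × Fin 2) ((SpaceTimeIdx Lf M × SectorLeg N₁) × Fin 2) ℂ)
    {κf sE cR cC δ ρ₃ : ℝ} (hκf : 0 < κf) (hGBf : ∀ t ∈ Set.Icc (0 : ℝ) 1, IsGramBoundedR (CLf + t • (CLf'' - CLf)) κf)
    (hsE0 : 0 ≤ sE) (hsE : ∀ x y, ‖(CLf'' - CLf) x y‖ ≤ sE) (hcR : 0 ≤ cR) (hcC : 0 ≤ cC)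
    (hER : ∀ x, ∑ y, ‖(CLf'' - CLf) x y‖ ≤ cR) (hEC : ∀ y, ∑ x, ‖(CLf'' - CLf) x y‖ ≤ cC)
    (hδ : 0 ≤ δ) (hδrow : ∀ x, ∑ y, ‖Tpf'' x y - Tpf x y‖ ≤ δ) (hδcol : ∀ y, ∑ x, ‖Tpf'' x y - Tpf x y‖ ≤ δ)
    (NB : ℕ → ℝ) (hNBdef : ∀ m', NB m' = (2 * m' : ℕ) * (cW + δ) ^ (2 * m' - 1) * δ * N𝒲' (2 * m')) (hρ₃ : 0 < ρ₃)
    (hθf₁ : Real.exp 1 * (αW' + (cR + cC)) * normV ((SpaceTimeIdx Lf M × SectorLeg N) × Fin 2) κf ρ₃ (fun m' => NW' m' + NB m') / κf ^ 2 < 1)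
    (hθf₂ : Real.exp 1 * αW' * (normV ((SpaceTimeIdx Lf M × SectorLeg N) × Fin 2) κf ρ₃ NW' + normV ((SpaceTimeIdx Lf M × SectorLeg N) × Fin 2) κf ρ₃ NB) / κf ^ 2 < 1)
    (n : ℕ) (p : Fin (n + 1)) :
    ∑ X ∈ univ.filter (fun X : Fin (n + 1) → ((SpaceTimeIdx Lf M × SectorLeg N) × Fin 2) => X p = w),
        ‖kernel ℂ (effAction ℂ Cd'' (ExteriorAlgebra.map (Matrix.toLin' Tpf'') 𝒲')) (n + 1) X -
          (if ∀ i, (ed (X i)).1 = (ed (X p)).1 then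
            kernel ℂ (effAction ℂ Cd (ExteriorAlgebra.map (Matrix.toLin' Tpc) 𝒲)) (n + 1) (fun i => (ed (X i)).2) else 0)‖ ≤
      (((((n + 1 + 1) * (n + 1 + 2) : ℕ) : ℝ) / 2 * sE *
          (ρ₃⁻¹ ^ (n + 3) * (Real.exp 1 * normV ((SpaceTimeIdx Lf M × SectorLeg N) × Fin 2) κf ρ₃ (fun m' => NW' m' + NB m')) /
            (1 - Real.exp 1 * (αW' + (cR + cC)) * normV ((SpaceTimeIdx Lf M × SectorLeg N) × Fin 2) κf ρ₃ (fun m' => NW' m' + NB m') / κf ^ 2)) +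
        ‖(2 : ℂ)⁻¹‖ * ∑ a' ∈ range (n + 2), ∑ b' ∈ range (n + 2),
          (if a' + b' = n + 1 then (((a' + 1) * (b' + 1) : ℕ) : ℝ) *
            (cR * (ρ₃⁻¹ ^ (a' + 1) * (Real.exp 1 * normV ((SpaceTimeIdx Lf M × SectorLeg N) × Fin 2) κf ρ₃ (fun m' => NW' m' + NB m')) /
                  (1 - Real.exp 1 * (αW' + (cR + cC)) * normV ((SpaceTimeIdx Lf M × SectorLeg N) × Fin 2) κf ρ₃ (fun m' => NW' m' + NB m') / κf ^ 2)) *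
                (ρ₃⁻¹ ^ (b' + 1) * (Real.exp 1 * normV ((SpaceTimeIdx Lf M × SectorLeg N) × Fin 2) κf ρ₃ (fun m' => NW' m' + NB m')) /
                  (1 - Real.exp 1 * (αW' + (cR + cC)) * normV ((SpaceTimeIdx Lf M × SectorLeg N) × Fin 2) κf ρ₃ (fun m' => NW' m' + NB m') / κf ^ 2)) +
              cC * (ρ₃⁻¹ ^ (a' + 1) * (Real.exp 1 * normV ((SpaceTimeIdx Lf M × SectorLeg N) × Fin 2) κf ρ₃ (fun m' => NW' m' + NB m')) /
                  (1 - Real.exp 1 * (αW' + (cR + cC)) * normV ((SpaceTimeIdx Lf M × SectorLeg N) × Fin 2) κf ρ₃ (fun m' => NW' m' + NB m') / κf ^ 2)) *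
                (ρ₃⁻¹ ^ (b' + 1) * (Real.exp 1 * normV ((SpaceTimeIdx Lf M × SectorLeg N) × Fin 2) κf ρ₃ (fun m' => NW' m' + NB m')) /
                  (1 - Real.exp 1 * (αW' + (cR + cC)) * normV ((SpaceTimeIdx Lf M × SectorLeg N) × Fin 2) κf ρ₃ (fun m' => NW' m' + NB m') / κf ^ 2))) else 0)) +
      ρ₃⁻¹ ^ (n + 1) * (Real.exp 1 * normV ((SpaceTimeIdx Lf M × SectorLeg N) × Fin 2) κf ρ₃ NB) / (1 - Real.exp 1 * αW' * (normV ((SpaceTimeIdx Lf M × SectorLeg N) × Fin 2) κf ρ₃ NW' + normV ((SpaceTimeIdx Lf M × SectorLeg N) × Fin 2) κf ρ₃ NB) / κf ^ 2) ^ 2) +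
      ((ρ'⁻¹ ^ (n + 1) * Real.exp 1 / (1 - Real.exp 1 * αW' * (normV ((SpaceTimeIdx Lf M × SectorLeg N) × Fin 2) κ' ρ' (fun m' => NV m' + (NW' m' + NV m')) + νEbar) / κ' ^ 2) ^ 2) * normV ((SpaceTimeIdx Lf M × SectorLeg N) × Fin 2) κ' ρ' Ein +
        (ρ'⁻¹ ^ (n + 1) * (Real.exp 1 * normV ((SpaceTimeIdx Lf M × SectorLeg N) × Fin 2) κ' ρ' (fun m' => NW' m' + NV m')) / (1 - Real.exp 1 * αW' * (normV ((SpaceTimeIdx Lf M × SectorLeg N) × Fin 2) κ' ρ' NV + normV ((SpaceTimeIdx Lf M × SectorLeg N) × Fin 2) κ' ρ' (fun m' => NW' m' + NV m')) / κ' ^ 2) ^ 2) * (1 + Λ * ((R' : ℝ) + 1))⁻¹ +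
        ((((n + 1 + 1) * (n + 1 + 2) : ℕ) : ℝ) / 2 *
            (ρ₂⁻¹ ^ (n + 3) * (Real.exp 1 * normV ((SpaceTimeIdx Lf M × SectorLeg N) × Fin 2) (κ' + κ + (κ' + κ + (κ' + κ))) ρ₂ Nw) / (1 - Real.exp 1 * (αW' + αW + (αW' + αW)) * normV ((SpaceTimeIdx Lf M × SectorLeg N) × Fin 2) (κ' + κ + (κ' + κ + (κ' + κ))) ρ₂ Nw / (κ' + κ + (κ' + κ + (κ' + κ))) ^ 2))) * (eW' / (1 + Λ * ((R : ℝ) + 1))) +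
        (‖(2 : ℂ)⁻¹‖ * ∑ a ∈ range (n + 2), ∑ b ∈ range (n + 2),
            (if a + b = n + 1 then (((a + 1) * (b + 1) : ℕ) : ℝ) *
              (4 * (ρ₂⁻¹ ^ (a + 1) * (Real.exp 1 * normV ((SpaceTimeIdx Lf M × SectorLeg N) × Fin 2) (κ' + κ + (κ' + κ + (κ' + κ))) ρ₂ Nw) / (1 - Real.exp 1 * (αW' + αW + (αW' + αW)) * normV ((SpaceTimeIdx Lf M × SectorLeg N) × Fin 2) (κ' + κ + (κ' + κ + (κ' + κ))) ρ₂ Nw / (κ' + κ + (κ' + κ + (κ' + κ))) ^ 2)) *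
                (ρ₂⁻¹ ^ (b + 1) * (Real.exp 1 * normV ((SpaceTimeIdx Lf M × SectorLeg N) × Fin 2) (κ' + κ + (κ' + κ + (κ' + κ))) ρ₂ Nw) / (1 - Real.exp 1 * (αW' + αW + (αW' + αW)) * normV ((SpaceTimeIdx Lf M × SectorLeg N) × Fin 2) (κ' + κ + (κ' + κ + (κ' + κ))) ρ₂ Nw / (κ' + κ + (κ' + κ + (κ' + κ))) ^ 2))) else 0)) * (αW' / (1 + Λ * ((R : ℝ) + 1))) +
        ((((n + 1 + 1) * (n + 1 + 2) : ℕ) : ℝ) / 2 * (sW' + sW) *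
              (ρf⁻¹ ^ (n + 3) * (Real.exp 1 * normV ((SpaceTimeIdx Lf M × SectorLeg N) × Fin 2) (κ' + κ) ρf Nw) / (1 - Real.exp 1 * (αW' + αW + (αW' + αW)) * normV ((SpaceTimeIdx Lf M × SectorLeg N) × Fin 2) (κ' + κ) ρf Nw / (κ' + κ) ^ 2)) +
            ‖(2 : ℂ)⁻¹‖ * ∑ a ∈ range (n + 2), ∑ b ∈ range (n + 2),
              (if a + b = n + 1 then (((a + 1) * (b + 1) : ℕ) : ℝ) *
                (2 * (αW' + αW) * (ρf⁻¹ ^ (a + 1) * (Real.exp 1 * normV ((SpaceTimeIdx Lf M × SectorLeg N) × Fin 2) (κ' + κ) ρf Nw) / (1 - Real.exp 1 * (αW' + αW + (αW' + αW)) * normV ((SpaceTimeIdx Lf M × SectorLeg N) × Fin 2) (κ' + κ) ρf Nw / (κ' + κ) ^ 2)) *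
                  (ρf⁻¹ ^ (b + 1) * (Real.exp 1 * normV ((SpaceTimeIdx Lf M × SectorLeg N) × Fin 2) (κ' + κ) ρf Nw) / (1 - Real.exp 1 * (αW' + αW + (αW' + αW)) * normV ((SpaceTimeIdx Lf M × SectorLeg N) × Fin 2) (κ' + κ) ρf Nw / (κ' + κ) ^ 2))) else 0)) * (Λ * ((R' : ℝ) + 1))⁻¹) := by
  classical
  have hΛ0 : 0 ≤ Λ := hΛ.le
  -- §1 the derived profiles: plain raw profile of `𝒲′`, weighted and plain even profile of the twin re-analysis `map T⁺[K] 𝒲′`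
  have hNX : ∀ (k : ℕ) (q : Fin k) (y : (SpaceTimeIdx Lf M × SectorLeg N₁) × Fin 2),
      ∑ Y ∈ univ.filter (fun Y : Fin k → (SpaceTimeIdx Lf M × SectorLeg N₁) × Fin 2 => Y q = y), ‖kernel ℂ 𝒲' k Y‖ ≤ N𝒲' k :=
    fun k q y => sum_filter_norm_kernel_le_of_weighted 𝒲' k q y _ (fun Y => by
      have := labelDiam_nonneg (fun Y₁ Y₂ : (SpaceTimeIdx Lf M × SectorLeg N₁) × Fin 2 => Λ₁ * (Torus.tnorm (Y₁.1.1.2 - Y₂.1.1.2) : ℝ)) (univ.image Y)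
      linarith) (hN𝒲'.le k q y)
  have hWp := wtProfileEven_map_of_wtProfileRaw Tpf ed ed₁ hTr hΛ0 hΛT hΛΛ₁ 𝒲' hN𝒲'
  have hNW' : WtProfileEven (ExteriorAlgebra.map (Matrix.toLin' Tpf) 𝒲') Λ NW' :=
    ⟨fun m' => by rw [hNW'def]; exact hWp.nonneg m', fun m' j x => by rw [hNW'def]; exact hWp.le m' j x⟩
  have hNWplain : ∀ m' (j : Fin (2 * m')) (x : (SpaceTimeIdx Lf M × SectorLeg N) × Fin 2),
      ∑ Y ∈ univ.filter (fun Y : Fin (2 * m') → (SpaceTimeIdx Lf M × SectorLeg N) × Fin 2 => Y j = x),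
        ‖kernel ℂ (ExteriorAlgebra.map (Matrix.toLin' Tpf) 𝒲') (2 * m') Y‖ ≤ NW' m' :=
    fun m' j x => sum_filter_norm_kernel_le_of_weighted _ (2 * m') j x _ (fun Y => by
      have := labelDiam_nonneg (fun Y₁ Y₂ : (SpaceTimeIdx Lf M × SectorLeg N) × Fin 2 => Λ * (Torus.tnorm (Y₁.1.1.2 - Y₂.1.1.2) : ℝ)) (univ.image Y)
      linarith) (hNW'.le m' j x)
  -- §2 the frame-composite data on the doubled legs
  set Ed : Matrix ((SpaceTimeIdx Lf M × SectorLeg N) × Fin 2) ((SpaceTimeIdx Lf M × SectorLeg N) × Fin 2) ℂ := Cd'' - Cd' with hEd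
  have hEd' : ∀ p q, Ed p q = if p.2 = 0 ∧ q.2 = 0 then (CLf'' - CLf) p.1 q.1 else 0 := by
    intro p' q; simp only [hEd, Matrix.sub_apply, hCd', hCd'']
    split_ifs <;> simp
  have hGBpath : ∀ t ∈ Set.Icc (0 : ℝ) 1, IsGramBoundedR (Cd' + t • Ed) κf :=
    isGramBoundedR_spectator_add_smul CLf (CLf'' - CLf) Cd' Ed hCd' hEd' hGBf
  have hw1 : ∀ (X Y : SpaceTimeIdx Lf M × SectorLeg N), (1 : ℝ) ≤ 1 + Λ * (Torus.tnorm (X.1.2 - Y.1.2) : ℝ) := fun X Y => by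
    have : (0 : ℝ) ≤ Torus.tnorm (X.1.2 - Y.1.2) := Nat.cast_nonneg _
    nlinarith
  have hrowC : ∀ x, ∑ y, ‖Cd' x y‖ ≤ αW' := by
    intro x
    have h := sum_norm_spectatorCov_mul_row_le CLf Cd' hCd' (fun _ => (1 : ℝ)) x hC'.αW_pos.le
      (sum_mul_le_of_sum_mul_le_of_le _ _ _ _ (fun _ _ => norm_nonneg _) (fun Y _ => hw1 x.1 Y) (hC'.row x.1))
    simpa only [mul_one] using h
  have hcolC : ∀ y, ∑ x, ‖Cd' x y‖ ≤ αW' := by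
    intro y
    have h := sum_norm_spectatorCov_mul_col_le CLf Cd' hCd' (fun _ => (1 : ℝ)) y hC'.αW_pos.le
      (sum_mul_le_of_sum_mul_le_of_le _ _ _ _ (fun _ _ => norm_nonneg _) (fun X _ => hw1 X y.1) (hC'.col y.1))
    simpa only [mul_one] using h
  have hsEd : ∀ p q, ‖Ed p q‖ ≤ sE := by
    intro p' q; rw [hEd']
    split_ifs
    · exact hsE _ _
    · rw [norm_zero]; exact hsE0
  have hERd : ∀ p, ∑ q, ‖Ed p q‖ ≤ cR := by
    intro p'
    have h := sum_norm_spectatorCov_mul_row_le (CLf'' - CLf) Ed hEd' (fun _ => (1 : ℝ)) p' hcR (by simpa only [mul_one] using hER p'.1)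
    simpa only [mul_one] using h
  have hECd : ∀ q, ∑ p, ‖Ed p q‖ ≤ cC := by
    intro q
    have h := sum_norm_spectatorCov_mul_col_le (CLf'' - CLf) Ed hEd' (fun _ => (1 : ℝ)) q hcC (by simpa only [mul_one] using hEC q.1)
    simpa only [mul_one] using h
  -- the common entrywise majorant of the two transfers
  set Tm : ((SpaceTimeIdx Lf M × SectorLeg N) × Fin 2) → ((SpaceTimeIdx Lf M × SectorLeg N₁) × Fin 2) → ℝ :=
    fun x y => ‖Tpf x y‖ + ‖Tpf'' x y - Tpf x y‖ with hTm
  have hT1 : ∀ x y, ‖Tpf x y‖ ≤ Tm x y := fun x y => le_add_of_nonneg_right (norm_nonneg _)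
  have hT2 : ∀ x y, ‖Tpf'' x y‖ ≤ Tm x y := fun x y => by
    have h := norm_add_le (Tpf x y) (Tpf'' x y - Tpf x y)
    rwa [add_sub_cancel] at h
  have hw1' : ∀ (x : (SpaceTimeIdx Lf M × SectorLeg N) × Fin 2) (y : (SpaceTimeIdx Lf M × SectorLeg N₁) × Fin 2),
      (1 : ℝ) ≤ 1 + ΛT * (Torus.tnorm (x.1.1.2 - y.1.1.2) : ℝ) := fun x y => by
    have : (0 : ℝ) ≤ Torus.tnorm (x.1.1.2 - y.1.1.2) := Nat.cast_nonneg _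
    nlinarith [hTr.ΛT_nonneg]
  have hTrow0 : ∀ x, ∑ y, ‖Tpf x y‖ ≤ cW := fun x => by
    have h := sum_mul_le_of_sum_mul_le_of_le univ (fun y => ‖Tpf x y‖) (fun _ => (1 : ℝ)) _ (fun _ _ => norm_nonneg _) (fun y _ => hw1' x y) (hTr.row x)
    simpa only [mul_one] using h
  have hTcol0 : ∀ y, ∑ x, ‖Tpf x y‖ ≤ cW := fun y => by
    have h := sum_mul_le_of_sum_mul_le_of_le univ (fun x => ‖Tpf x y‖) (fun _ => (1 : ℝ)) _ (fun _ _ => norm_nonneg _) (fun x _ => hw1' x y) (hTr.col y)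
    simpa only [mul_one] using h
  have hTmrow : ∀ x, ∑ y, Tm x y ≤ cW + δ := fun x => by
    simp only [hTm, sum_add_distrib]; exact add_le_add (hTrow0 x) (hδrow x)
  have hTmcol : ∀ y, ∑ x, Tm x y ≤ cW + δ := fun y => by
    simp only [hTm, sum_add_distrib]; exact add_le_add (hTcol0 y) (hδcol y)
  have ha0 : 0 ≤ cW + δ := add_nonneg hTr.cW_nonneg hδ
  -- §3 the frame composite (M3f) at the twin, then `C⁺[K] + (C⁺[K″] − C⁺[K]) = C⁺[K″]`
  have hM3f := sum_norm_kernel_frameComposite_le (𝕜 := ℂ) Cd' Ed Tpf Tpf'' 𝒲' h𝒲'e h𝒲'0 hκf hGBpath hC'.αW_pos hrowC hcolC hsEd hcR hcC hERd hECd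
    Tm ha0 hδ hT1 hT2 hTmcol hTmrow hδcol hδrow N𝒲' hN𝒲'.nonneg hNX NW' hNW'.nonneg
    (fun m' j x => by convert hNWplain m' j x using 6) NB hNBdef hρ₃ hθf₁ hθf₂ w n p
  rw [hEd, add_sub_cancel] at hM3f
  -- §4 the two-volume step (MinS, bundled) at the twin
  have hMinS := srcSector_sum_norm_kernel_twoVolume_scaleSucc_bundledP_le hLf hβ hΛ e he1 he2 ed hed e₁ he₁1 he₁2 ed₁ hed₁ 𝔣t Φ FtL FtLf hFtL hFtLf
    pL pLf hpL hpLf CL hCL CLf hCLf Cd hCd Cd' hCd' Tc Tf hPT₀ Jc Jf hPJ Tpc hTpc Tpf hTpf R R' RN RZ RF r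
    hNZ hrN hrF hrZR w hw hC hC' hCsec hTr 𝒲 h𝒲e h𝒲0 𝒲' h𝒲'e h𝒲'0 hΛ₁ N𝒲 NV NW' hN𝒲 hNV hNW' hρ₀ hθ₀ Nw hNwdef hρf hθw hρ₂ hθ₂ Ej NDj hD Ein hEin0 hEin
    hρ' hνE hbar hθ₂' n p
  -- §5 splice
  exact sum_norm_keyedGlued_le_of_fine_response ed _ _ _ p _ (by convert hM3f using 3) hMinS

end Summit.HubbardSuperconductivity.HubbardSuperconductivity.Theorems.TwoVolumeDefect

end
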